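import Mathlib
import Summits.ResolutionOfSingularities.ResolutionOfSingularities.Theorems.WildQuotientsWildQuotientResolutionS1W1NTypeNSheared
import Summits.ResolutionOfSingularities.ResolutionOfSingularities.Theorems.WildQuotientsWildQuotientResolutionS1W1NCascade
import Literature.NumberTheory.EllipticCurves.FormalGroupLaw

/-!
# S1 / W1N cascade — Part VI: B6-forward (Nakayama), the strong type-N step, the support `NTwoExit`; discharges `isolatedSucc_holds`, `oStep_holds`, `nTwoExit_holds`

Crux stmt-ResolutionOfSingularities-17941 (`WildQuotients.CyclicQuotientFourfolds`), S1a line `s1a-logminvertex`,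
stub `stub_W1N_print`, sub-line `w1n-cascade` (idea-1 `W1N-LINE.md`; proofs from `CombinedW1NPrint.scratch.lean`
f33256b0cfc42851).  [OURS · L1 W4.5c] — NOT a statement of the manuscript; counted 0 post-V5.

`milnor_le_two_of_sheared` (B6-forward: `b₂₀ ≠ 0` at a sheared type-N node forces `μ ≤ 2`, by Nakayama),
`typeN_step_linearPart_eq_zero` (from type N with `μ ≥ 3` every bad isolated successor is of type O with
`μ' ≤ μ + 1`), `nTwoExit_unfolded`, and the one-line discharges `W1NCascade.isolatedSucc_holds : IsolatedSucc`
(Part I of the transport toolkit), `W1NCascade.oStep_holds : OStep` (W-4b's `milnor_lt_of_isSucc`) and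
`W1NCascade.nTwoExit_holds : NTwoExit`.
-/

-- single-problem summit: the doubled namespace component `ResolutionOfSingularities` is forced
set_option linter.dupNamespace false

noncomputable section

open MvPowerSeries IsLocalRing
open Literature.AlgebraicGeometry.Resolution
open Summit.ResolutionOfSingularities.ResolutionOfSingularities.Theorems.WildCones.MuDropCharTwoOrdP

namespace Summit.ResolutionOfSingularities.ResolutionOfSingularities.Theorems.WildQuotientResolution.S1.PlanarField

variable {κ : Type} [Field κ]

/-! ## Part VI — B6-forward (jets bound the Milnor number from ABOVE, by Nakayama), the strong type-N step,
and the support `NTwoExit` -/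

-- (`finTwo_eq` = the tree's `Literature.NumberTheory.EllipticCurves.finsupp_fin_two_eq`, reused — gate dedup)

/-- A series whose coefficients of degree `≤ 2` vanish lies in `𝔪³`. [folklore] -/
theorem mem_maximalIdeal_pow_three {r : MvPowerSeries (Fin 2) κ}
    (h : ∀ i j : ℕ, i + j < 3 → coeff (Finsupp.single 0 i + Finsupp.single 1 j) r = 0) :
    r ∈ maximalIdeal (MvPowerSeries (Fin 2) κ) ^ 3 := by
  refine Literature.RingTheory.MvPowerSeries.Jets.mem_maximalIdeal_pow_of_coeff_eq_zero fun e he => ?_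
  obtain ⟨i, j, rfl⟩ : ∃ i j : ℕ, e = Finsupp.single 0 i + Finsupp.single 1 j :=
    ⟨e 0, e 1, Literature.NumberTheory.EllipticCurves.finsupp_fin_two_eq e⟩
  rw [map_add, Finsupp.degree_single, Finsupp.degree_single] at he
  exact h i j he

/-- `[x^i y^j] x² `. [folklore] -/
theorem coeff_pair_X_zero_sq (i j : ℕ) :
    coeff (Finsupp.single 0 i + Finsupp.single 1 j) (X 0 ^ 2 : MvPowerSeries (Fin 2) κ) =
      if i = 2 ∧ j = 0 then 1 else 0 := by
  classical
  have e : (Finsupp.single 0 2 : Fin 2 →₀ ℕ) = Finsupp.single 0 2 + Finsupp.single 1 0 := by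
    rw [Finsupp.single_zero, add_zero]
  rw [coeff_X_pow, e]
  simp only [finTwo_pair_eq_iff]

/-- `[x^i y^j] y² `. [folklore] -/
theorem coeff_pair_X_one_sq (i j : ℕ) :
    coeff (Finsupp.single 0 i + Finsupp.single 1 j) (X 1 ^ 2 : MvPowerSeries (Fin 2) κ) =
      if i = 0 ∧ j = 2 then 1 else 0 := by
  classical
  have e : (Finsupp.single 1 2 : Fin 2 →₀ ℕ) = Finsupp.single 0 0 + Finsupp.single 1 2 := by
    rw [Finsupp.single_zero, zero_add]
  rw [coeff_X_pow, e]
  simp only [finTwo_pair_eq_iff]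

/-- `[x^i y^j] x y `. [folklore] -/
theorem coeff_pair_X_zero_mul_X_one (i j : ℕ) :
    coeff (Finsupp.single 0 i + Finsupp.single 1 j) (X 0 * X 1 : MvPowerSeries (Fin 2) κ) =
      if i = 1 ∧ j = 1 then 1 else 0 := by
  classical
  rw [X_def, X_def, monomial_mul_monomial, one_mul, coeff_monomial]
  simp only [finTwo_pair_eq_iff]

/-- Scalars pass to the quotient as scalar multiples of `1`. [folklore] -/
theorem mk_C_eq_smul_one (I : Ideal (MvPowerSeries (Fin 2) κ)) (c : κ) :
    Ideal.Quotient.mk I (C c) = c • (1 : MvPowerSeries (Fin 2) κ ⧸ I) := by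
  have h1 : Ideal.Quotient.mk I (C c) = algebraMap κ (MvPowerSeries (Fin 2) κ ⧸ I) c := by
    rw [← Ideal.Quotient.mk_algebraMap, MvPowerSeries.algebraMap_apply, Algebra.algebraMap_self_apply]
  rw [h1, Algebra.algebraMap_eq_smul_one]

/-- **B6-forward (the 2-jet bounds `μ` from above).**  A sheared singular node — `a₁₀ = 0 ≠ a₀₁`,
`b₁₀ = b₀₁ = 0` — with `b₂₀ ≠ 0` has Milnor number `≤ 2`.  Proof: `𝔪² ≤ (a,b) + 𝔪³` from
`x·a ≡ a₀₁·xy`, `y·a ≡ a₀₁·y²`, `b ≡ b₂₀x² + b₁₁xy + b₀₂y²  (mod 𝔪³)`; NAKAYAMA gives `𝔪² ≤ (a,b)`, then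
`y ∈ (a,b)` and `κ⟦x,y⟧/(a,b)` is spanned by `1, x`. [OURS · L1 W4.5c] -/
theorem milnor_le_two_of_sheared (θ : PlanarField κ) (hsing : θ.IsSingular)
    (h00 : θ.linearPart 0 0 = 0) (h01 : θ.linearPart 0 1 ≠ 0) (h10 : θ.linearPart 1 0 = 0)
    (h11 : θ.linearPart 1 1 = 0) (hb20 : coeff (Finsupp.single 0 2) θ.b ≠ 0) : θ.milnor ≤ 2 := by
  classical
  have ha10 : coeff (Finsupp.single 0 1) θ.a = 0 := by rwa [linearPart_apply_zero] at h00
  have hb10 : coeff (Finsupp.single 0 1) θ.b = 0 := by rwa [linearPart_apply_one] at h10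
  have hb01 : coeff (Finsupp.single 1 1) θ.b = 0 := by rwa [linearPart_apply_one] at h11
  have hβa : coeff (Finsupp.single 1 1) θ.a = θ.linearPart 0 1 := (linearPart_apply_zero θ 1).symm
  have hX0 : (X 0 : MvPowerSeries (Fin 2) κ) ∈ maximalIdeal (MvPowerSeries (Fin 2) κ) :=
    mem_maximalIdeal_of_constantCoeff_eq_zero (constantCoeff_X 0)
  have hX1 : (X 1 : MvPowerSeries (Fin 2) κ) ∈ maximalIdeal (MvPowerSeries (Fin 2) κ) :=
    mem_maximalIdeal_of_constantCoeff_eq_zero (constantCoeff_X 1)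
  have haI : θ.a ∈ Ideal.span {θ.a, θ.b} := Ideal.subset_span (by simp)
  have hbI : θ.b ∈ Ideal.span {θ.a, θ.b} := Ideal.subset_span (by simp)
  have hm3 : ∀ {u v : MvPowerSeries (Fin 2) κ}, u ∈ maximalIdeal (MvPowerSeries (Fin 2) κ) →
      v ∈ maximalIdeal (MvPowerSeries (Fin 2) κ) ^ 2 → u * v ∈ maximalIdeal (MvPowerSeries (Fin 2) κ) ^ 3 :=
    fun hu hv => by rw [pow_succ']; exact Ideal.mul_mem_mul hu hv
  -- the linear part of `a` is `a₀₁ · y`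
  have haβ : θ.a - C (θ.linearPart 0 1) * X 1 ∈ maximalIdeal (MvPowerSeries (Fin 2) κ) ^ 2 := by
    refine Literature.RingTheory.MvPowerSeries.Jets.mem_maximalIdeal_pow_of_le_order
      ((FormalCoordChange.two_le_order_iff _).mpr ⟨?_, fun i => ?_⟩)
    · rw [map_sub, map_mul, constantCoeff_C, constantCoeff_X, mul_zero, sub_zero]; exact hsing.1
    · fin_cases i
      · show coeff (Finsupp.single 0 1) (θ.a - C (θ.linearPart 0 1) * X 1) = 0
        rw [map_sub, coeff_C_mul, coeff_index_single_X, if_neg Fin.zero_ne_one, mul_zero, sub_zero, ha10]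
      · show coeff (Finsupp.single 1 1) (θ.a - C (θ.linearPart 0 1) * X 1) = 0
        rw [map_sub, coeff_C_mul, coeff_index_single_self_X, mul_one, hβa, sub_self]
  -- `xy, y², x² ∈ (a,b) + 𝔪³`
  have hxy : (X 0 * X 1 : MvPowerSeries (Fin 2) κ) ∈
      Ideal.span {θ.a, θ.b} ⊔ maximalIdeal (MvPowerSeries (Fin 2) κ) ^ 3 := by
    have h1 : C (θ.linearPart 0 1) * (X 0 * X 1) = X 0 * θ.a - X 0 * (θ.a - C (θ.linearPart 0 1) * X 1) := by
      ring
    have h2 : C (θ.linearPart 0 1) * (X 0 * X 1) ∈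
        Ideal.span {θ.a, θ.b} ⊔ maximalIdeal (MvPowerSeries (Fin 2) κ) ^ 3 := by
      rw [h1]
      exact Submodule.sub_mem _ (Ideal.mem_sup_left (Ideal.mul_mem_left _ _ haI))
        (Ideal.mem_sup_right (hm3 hX0 haβ))
    have h3 := Ideal.mul_mem_left _ (C (θ.linearPart 0 1)⁻¹) h2
    rwa [← mul_assoc, ← map_mul, inv_mul_cancel₀ h01, map_one, one_mul] at h3
  have hyy : (X 1 ^ 2 : MvPowerSeries (Fin 2) κ) ∈
      Ideal.span {θ.a, θ.b} ⊔ maximalIdeal (MvPowerSeries (Fin 2) κ) ^ 3 := by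
    have h1 : C (θ.linearPart 0 1) * X 1 ^ 2 = X 1 * θ.a - X 1 * (θ.a - C (θ.linearPart 0 1) * X 1) := by
      ring
    have h2 : C (θ.linearPart 0 1) * X 1 ^ 2 ∈
        Ideal.span {θ.a, θ.b} ⊔ maximalIdeal (MvPowerSeries (Fin 2) κ) ^ 3 := by
      rw [h1]
      exact Submodule.sub_mem _ (Ideal.mem_sup_left (Ideal.mul_mem_left _ _ haI))
        (Ideal.mem_sup_right (hm3 hX1 haβ))
    have h3 := Ideal.mul_mem_left _ (C (θ.linearPart 0 1)⁻¹) h2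
    rwa [← mul_assoc, ← map_mul, inv_mul_cancel₀ h01, map_one, one_mul] at h3
  have hxx : (X 0 ^ 2 : MvPowerSeries (Fin 2) κ) ∈
      Ideal.span {θ.a, θ.b} ⊔ maximalIdeal (MvPowerSeries (Fin 2) κ) ^ 3 := by
    have hr : θ.b - C (coeff (Finsupp.single 0 2) θ.b) * X 0 ^ 2
        - C (coeff (Finsupp.single 0 1 + Finsupp.single 1 1) θ.b) * (X 0 * X 1)
        - C (coeff (Finsupp.single 1 2) θ.b) * X 1 ^ 2 ∈ maximalIdeal (MvPowerSeries (Fin 2) κ) ^ 3 := by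
      refine mem_maximalIdeal_pow_three fun i j hij => ?_
      simp only [map_sub, coeff_C_mul, coeff_pair_X_zero_sq, coeff_pair_X_one_sq, coeff_pair_X_zero_mul_X_one]
      have hi : i ≤ 2 := by omega
      have hj : j ≤ 2 := by omega
      have hb00 : constantCoeff θ.b = 0 := hsing.2
      interval_cases i <;> interval_cases j <;> first | omega | simp [hb00, hb10, hb01]
    have h1 : C (coeff (Finsupp.single 0 2) θ.b) * X 0 ^ 2 = θ.b - (θ.b - C (coeff (Finsupp.single 0 2) θ.b)
        * X 0 ^ 2 - C (coeff (Finsupp.single 0 1 + Finsupp.single 1 1) θ.b) * (X 0 * X 1)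
        - C (coeff (Finsupp.single 1 2) θ.b) * X 1 ^ 2)
        - C (coeff (Finsupp.single 0 1 + Finsupp.single 1 1) θ.b) * (X 0 * X 1)
        - C (coeff (Finsupp.single 1 2) θ.b) * X 1 ^ 2 := by ring
    have h2 : C (coeff (Finsupp.single 0 2) θ.b) * X 0 ^ 2 ∈
        Ideal.span {θ.a, θ.b} ⊔ maximalIdeal (MvPowerSeries (Fin 2) κ) ^ 3 := by
      rw [h1]
      exact Submodule.sub_mem _ (Submodule.sub_mem _ (Submodule.sub_mem _ (Ideal.mem_sup_left hbI)
        (Ideal.mem_sup_right hr)) (Ideal.mul_mem_left _ _ hxy)) (Ideal.mul_mem_left _ _ hyy)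
    have h3 := Ideal.mul_mem_left _ (C (coeff (Finsupp.single 0 2) θ.b)⁻¹) h2
    rwa [← mul_assoc, ← map_mul, inv_mul_cancel₀ hb20, map_one, one_mul] at h3
  -- `𝔪² ≤ (a,b) + 𝔪³`
  have hxx' : monomial (Finsupp.single 0 2) (1 : κ) ∈
      Ideal.span {θ.a, θ.b} ⊔ maximalIdeal (MvPowerSeries (Fin 2) κ) ^ 3 := by rwa [X_pow_eq] at hxx
  have hyy' : monomial (Finsupp.single 1 2) (1 : κ) ∈
      Ideal.span {θ.a, θ.b} ⊔ maximalIdeal (MvPowerSeries (Fin 2) κ) ^ 3 := by rwa [X_pow_eq] at hyy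
  have hxy' : monomial (Finsupp.single 0 1 + Finsupp.single 1 1) (1 : κ) ∈
      Ideal.span {θ.a, θ.b} ⊔ maximalIdeal (MvPowerSeries (Fin 2) κ) ^ 3 := by
    rwa [X_def, X_def, monomial_mul_monomial, one_mul] at hxy
  have hm2 : maximalIdeal (MvPowerSeries (Fin 2) κ) ^ 2 ≤
      Ideal.span {θ.a, θ.b} ⊔ maximalIdeal (MvPowerSeries (Fin 2) κ) ^ 3 := by
    rw [Literature.RingTheory.MvPowerSeries.Jets.maximalIdeal_pow_eq_span_monomial 2, Ideal.span_le]
    rintro _ ⟨e, he, rfl⟩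
    obtain ⟨i, j, rfl⟩ : ∃ i j : ℕ, e = Finsupp.single 0 i + Finsupp.single 1 j :=
    ⟨e 0, e 1, Literature.NumberTheory.EllipticCurves.finsupp_fin_two_eq e⟩
    replace he : i + j = 2 := by
      have := he; rw [Set.mem_setOf_eq, map_add, Finsupp.degree_single, Finsupp.degree_single] at this
      exact this
    have hi : i ≤ 2 := by omega
    have hj : j ≤ 2 := by omega
    interval_cases i <;> interval_cases j <;>
      first
        | omega
        | exact hxy'
        | (simp only [Finsupp.single_zero, zero_add, add_zero]; first | exact hxx' | exact hyy')
  -- Nakayama: `𝔪² ≤ (a,b)`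
  have hfg : (maximalIdeal (MvPowerSeries (Fin 2) κ) ^ 2).FG := by
    rw [Literature.RingTheory.MvPowerSeries.Jets.maximalIdeal_pow_eq_span_monomial 2]
    refine Submodule.fg_def.mpr ⟨_, ?_, rfl⟩
    exact ((Finsupp.finite_of_degree_lt (σ := Fin 2) 3).subset fun e (he : e.degree = 2) =>
      show e.degree < 3 by rw [he]; norm_num).image _
  have hm2I : maximalIdeal (MvPowerSeries (Fin 2) κ) ^ 2 ≤ Ideal.span {θ.a, θ.b} := by
    refine Submodule.le_of_le_smul_of_le_jacobson_bot (I := maximalIdeal (MvPowerSeries (Fin 2) κ)) hfg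
      (IsLocalRing.maximalIdeal_le_jacobson _) ?_
    have h3 : maximalIdeal (MvPowerSeries (Fin 2) κ) • maximalIdeal (MvPowerSeries (Fin 2) κ) ^ 2 =
        maximalIdeal (MvPowerSeries (Fin 2) κ) ^ 3 := by
      rw [Ideal.smul_eq_mul, ← pow_succ']
    rw [h3]
    exact hm2
  -- `y ∈ (a,b)`
  have hy : (X 1 : MvPowerSeries (Fin 2) κ) ∈ Ideal.span {θ.a, θ.b} := by
    have h1 : C (θ.linearPart 0 1) * X 1 = θ.a - (θ.a - C (θ.linearPart 0 1) * X 1) := by ring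
    have h2 : C (θ.linearPart 0 1) * X 1 ∈ Ideal.span {θ.a, θ.b} := by
      rw [h1]; exact Submodule.sub_mem _ haI (hm2I haβ)
    have h3 := Ideal.mul_mem_left _ (C (θ.linearPart 0 1)⁻¹) h2
    rwa [← mul_assoc, ← map_mul, inv_mul_cancel₀ h01, map_one, one_mul] at h3
  -- `κ⟦x,y⟧/(a,b)` is spanned by `1, x`
  have hspan : Submodule.span κ
      ((({1, Ideal.Quotient.mk (Ideal.span {θ.a, θ.b}) (X 0)} :
        Finset (MvPowerSeries (Fin 2) κ ⧸ Ideal.span {θ.a, θ.b})) :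
        Set (MvPowerSeries (Fin 2) κ ⧸ Ideal.span {θ.a, θ.b}))) = ⊤ := by
    rw [eq_top_iff]
    rintro q -
    obtain ⟨f, rfl⟩ := Ideal.Quotient.mk_surjective q
    have hr : f - C (constantCoeff f) - C (coeff (Finsupp.single 0 1) f) * X 0
        - C (coeff (Finsupp.single 1 1) f) * X 1 ∈ maximalIdeal (MvPowerSeries (Fin 2) κ) ^ 2 := by
      refine Literature.RingTheory.MvPowerSeries.Jets.mem_maximalIdeal_pow_of_le_order
        ((FormalCoordChange.two_le_order_iff _).mpr ⟨?_, fun i => ?_⟩)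
      · simp
      · fin_cases i
        · show coeff (Finsupp.single 0 1) _ = 0
          simp [coeff_C_mul, coeff_index_single_X, coeff_C]
        · show coeff (Finsupp.single 1 1) _ = 0
          simp [coeff_C_mul, coeff_index_single_X, coeff_C]
    have hfI : f - (C (constantCoeff f) + C (coeff (Finsupp.single 0 1) f) * X 0) ∈ Ideal.span {θ.a, θ.b} := by
      have : f - (C (constantCoeff f) + C (coeff (Finsupp.single 0 1) f) * X 0) =
          C (coeff (Finsupp.single 1 1) f) * X 1 + (f - C (constantCoeff f)
            - C (coeff (Finsupp.single 0 1) f) * X 0 - C (coeff (Finsupp.single 1 1) f) * X 1) := by ring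
      rw [this]
      exact Ideal.add_mem _ (Ideal.mul_mem_left _ _ hy) (hm2I hr)
    rw [(Ideal.Quotient.eq).mpr hfI, map_add, map_mul, mk_C_eq_smul_one, mk_C_eq_smul_one, smul_mul_assoc,
      one_mul]
    exact Submodule.add_mem _ (Submodule.smul_mem _ _ (Submodule.subset_span (by simp)))
      (Submodule.smul_mem _ _ (Submodule.subset_span (by simp)))
  show Module.finrank κ (MvPowerSeries (Fin 2) κ ⧸ Ideal.span {θ.a, θ.b}) ≤ 2
  calc Module.finrank κ (MvPowerSeries (Fin 2) κ ⧸ Ideal.span {θ.a, θ.b})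
      = Module.finrank κ (⊤ : Submodule κ (MvPowerSeries (Fin 2) κ ⧸ Ideal.span {θ.a, θ.b})) := by
        rw [finrank_top]
    _ = Module.finrank κ (Submodule.span κ ((({1, Ideal.Quotient.mk (Ideal.span {θ.a, θ.b}) (X 0)} :
        Finset (MvPowerSeries (Fin 2) κ ⧸ Ideal.span {θ.a, θ.b})) :
        Set (MvPowerSeries (Fin 2) κ ⧸ Ideal.span {θ.a, θ.b})))) := by rw [hspan]
    _ ≤ ({1, Ideal.Quotient.mk (Ideal.span {θ.a, θ.b}) (X 0)} :
        Finset (MvPowerSeries (Fin 2) κ ⧸ Ideal.span {θ.a, θ.b})).card := finrank_span_finset_le_card _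
    _ ≤ 2 := Finset.card_le_two

/-- **THE STRONG TYPE-N STEP.**  If an isolated bad node `θ` with `linearPart ≠ 0` and `μ(θ) ≥ 3` has a
bad isolated successor `θ'`, then `linearPart θ' = 0` (the successor is of type O) and
`μ(θ') ≤ μ(θ) + 1`.  (`b₂₀ ≠ 0` would force `μ(θ) ≤ 2` by B6-forward.) [OURS · L1 W4.5c] -/
theorem typeN_step_linearPart_eq_zero (θ θ' : PlanarField κ) (hiso : θ.IsIsolated) (hbad : θ.IsBadNode)
    (hL : θ.linearPart ≠ 0) (hμ : 3 ≤ θ.milnor) (hsucc : θ.IsSucc θ') (hiso' : θ'.IsIsolated)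
    (hbad' : θ'.IsBadNode) : θ'.linearPart = 0 ∧ θ'.milnor ≤ θ.milnor + 1 := by
  revert hiso hbad hL hμ hiso' hbad'
  refine forall_isSucc_of_chart1_zero
    (P := fun θ θ' => θ.IsIsolated → θ.IsBadNode → θ.linearPart ≠ 0 → 3 ≤ θ.milnor → θ'.IsIsolated →
      θ'.IsBadNode → θ'.linearPart = 0 ∧ θ'.milnor ≤ θ.milnor + 1)
    ?_ ?_ ?_ θ θ' hsucc
  · intro c θ θ' h hiso hbad hL hμ hiso' hbad'
    have := h ((isIsolated_shear_iff c θ).mpr hiso) ((isBadNode_shear_iff c θ).mpr hbad)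
      (fun h0 => hL ((linearPart_shear_eq_zero_iff c θ).mp h0)) (by rwa [milnor_shear]) hiso' hbad'
    rwa [milnor_shear] at this
  · intro θ θ' h hiso hbad hL hμ hiso' hbad'
    have := h ((isIsolated_swapField_iff θ).mpr hiso) ((isBadNode_swapField_iff θ).mpr hbad)
      (fun h0 => hL ((linearPart_swapField_eq_zero_iff θ).mp h0)) (by rwa [milnor_swapField])
      ((isIsolated_swapField_iff θ').mpr hiso') ((isBadNode_swapField_iff θ').mpr hbad')
    rwa [milnor_swapField, milnor_swapField, linearPart_swapField_eq_zero_iff] at this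
  · intro θ θ' h hiso hbad hL hμ hiso' hbad'
    obtain ⟨⟨h00, h01, h10, h11⟩, h1, -, hL'⟩ := typeN_chart1_zero_step θ θ' hiso hbad hL h hiso' hbad'
    refine ⟨?_, h1⟩
    have hb20 : coeff (Finsupp.single 0 2) θ.b = 0 := by
      by_contra hb20
      have := milnor_le_two_of_sheared θ hbad.1 h00 h01 h10 h11 hb20
      omega
    rw [hL', hb20]
    ext i j
    fin_cases i <;> fin_cases j <;> simp

/-- **The support `NTwoExit`, unfolded.**  From an isolated bad node of type N with `μ = 2`, along
successors `θ → θ₁ → θ₂ → θ₃` with `θ₁, θ₂` isolated bad and `θ₃` isolated: `θ₃` is NOT bad.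
(`μ(θ₁) = 3` by the type-N step; `θ₁` is of type N since a type-O node with an isolated successor has
`μ ≥ 4`; so `θ₂` is of type O with `μ(θ₂) ≤ 4` by the strong type-N step; then the terminal step.)
[OURS · L1 W4.5c] -/
theorem nTwoExit_unfolded (θ θ₁ θ₂ θ₃ : PlanarField κ) (hiso : θ.IsIsolated) (hbad : θ.IsBadNode)
    (hL : θ.linearPart ≠ 0) (hμ : θ.milnor = 2) (h₁ : θ.IsSucc θ₁) (h₂ : θ₁.IsSucc θ₂) (h₃ : θ₂.IsSucc θ₃)
    (hiso₁ : θ₁.IsIsolated) (hbad₁ : θ₁.IsBadNode) (hiso₂ : θ₂.IsIsolated) (hbad₂ : θ₂.IsBadNode)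
    (hiso₃ : θ₃.IsIsolated) : ¬ θ₃.IsBadNode := by
  obtain ⟨hle, hge⟩ := typeN_step θ θ₁ hiso hbad hL h₁ hiso₁ hbad₁
  have hμ₁ : θ₁.milnor = 3 := by omega
  have hL₁ : θ₁.linearPart ≠ 0 := by
    intro hL₁
    have := four_le_milnor_of_isSucc θ₁ θ₂ hiso₁ hbad₁ hL₁ h₂ hiso₂
    omega
  obtain ⟨hL₂, hle₂⟩ := typeN_step_linearPart_eq_zero θ₁ θ₂ hiso₁ hbad₁ hL₁ (by omega) h₂ hiso₂ hbad₂
  exact not_isBadNode_of_milnor_le_four_of_isSucc θ₂ θ₃ hiso₂ hbad₂ hL₂ (by omega) h₃ hiso₃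

end Summit.ResolutionOfSingularities.ResolutionOfSingularities.Theorems.WildQuotientResolution.S1.PlanarField

namespace Summit.ResolutionOfSingularities.ResolutionOfSingularities.Theorems.WildQuotientResolution.S1.W1NCascade

/-- **Discharge of the support `IsolatedSucc`** (successors of an isolated node are isolated; Part I of the
transport toolkit, `PlanarField.isIsolated_of_isSucc`). -/
theorem isolatedSucc_holds : IsolatedSucc := fun _ _ θ θ' => PlanarField.isIsolated_of_isSucc θ θ'

/-- **Discharge of the support `OStep`** (type O: the Milnor number drops at every isolated successor). -/
theorem oStep_holds : OStep := fun _ _ θ θ' => PlanarField.milnor_lt_of_isSucc θ θ'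

/-- **Discharge of the support `NTwoExit`** (type N with `μ = 2`: the third successor is not bad). -/
theorem nTwoExit_holds : NTwoExit := fun _ _ θ θ₁ θ₂ θ₃ => PlanarField.nTwoExit_unfolded θ θ₁ θ₂ θ₃

end Summit.ResolutionOfSingularities.ResolutionOfSingularities.Theorems.WildQuotientResolution.S1.W1NCascade

end
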